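import Mathlib
import HarnessLib
import Summits.NavierStokesRegularity.NavierStokesRegularity.Theorems.PoloidalWindowDoorPoloidalWindowRigidityUntwistedIsoparametric
import Summits.NavierStokesRegularity.NavierStokesRegularity.Theorems.PoloidalWindowDoorLrcModEntireStreamSymmetryGerm
import Summits.NavierStokesRegularity.NavierStokesRegularity.Theorems.PoloidalWindowDoorPoloidalWindowRigidityStructureFunction
import Summits.NavierStokesRegularity.NavierStokesRegularity.Theorems.PoloidalWindowDoorPoloidalWindowRigidityLocalVorticitySymmetry
import Summits.NavierStokesRegularity.NavierStokesRegularity.Theorems.PoloidalWindowDoorPoloidalWindowRigidityOneSliceCurlAxisymmetric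

/-!
# Route `PoloidalWindowDoor`, crux `PoloidalWindowRigidity` (K2, stmt-NavierStokesRegularity-19708), skeleton `lrc-jet` v5,
# stub `stub_untwisted` — brick F5 (part 2, class half): A GERM OF `v₂(s,·)` IS A GERM OF THE VORTICITY ⇒ REGULAR

Cell ns-regularity-ideate, seat ns-poloidal-K2-p3 (gen 6; `--supports stmt-NavierStokesRegularity-19708`, helper toward the registered
stub `stub_untwisted` of `Cruxes/PoloidalWindowRigidity/Lines/lrc_jet.lean` v5 and toward item stmt-20428 `LrcModEntire` (twist-split
skeleton, stub `stub_untwistedGerm`); paper proof = `Cruxes/PoloidalWindowRigidity/UNTWISTED-NOTE.md` §3 CONCLUSION; sequel of the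
pure-calculus file `…UntwistedIsoparametric` — split for file size).

* `vorticityGerm_of_verticalVelocity_germ` — **class transfer.**  For a profile of the route's Type-I class, poloidal along `e₃`, a slice
  `s < 0` and an open `V ∋ y₀` with `∇ₕv₂(s,y₀) ≠ 0`: a rotation germ `Dw(y)[J(y − c)] = 0` / horizontal-translation germ `Dw(y)[e] = 0`
  of `w = v₂(s,·)` on `V` is, on an open `V' ∋ y₀`, a germ of the tree's Clebsch stream function `ψ(s,·)` (`ψ = F̃(s, v₂, y₂)` near
  non-degenerate points, K2-p3's `…StructureFunction.exists_clebsch_eq_structureFunction`; chain rule along a horizontal vector killed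
  by `Dw`), hence (K2-p3's `…StreamSymmetryGerm`) of the VORTICITY: `D(curl v(s))[e] = 0`, resp. `J curl v(s) = D(curl v(s))[J(· − c)]`.
* `not_isBackwardSingularPoint_of_verticalVelocity_germ` (tree `nonflatLiouville_of_local_curl_translation` /
  `nonflatLiouville_of_curl_rotDefect_eq_zero_on_open`) and `lrcGerm_of_verticalVelocity_germ` (the first two legs of the germ
  trichotomy of `LrcModEntire`, VERBATIM its conclusion).
* `not_isBackwardSingularPoint_of_leafwise` / `lrcGerm_of_leafwise` — **BRICK F5 ASSEMBLED:** class + slice `s` + open `U ∋ y₀` with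
  `∇ₕv₂(s,y₀) ≠ 0` + untwisted structure function (`∂₂v₂ = P(v₂,y₂)` on `U`, `P ∈ C¹` at the leaf points) + isoparametric leaves
  (`|∇ₕv₂|² = a(v₂,y₂)`, `Δₕv₂ = b(v₂,y₂)` on `U`, `a ∈ C²`, `b ∈ C¹` at the base leaf point) ⇒ `¬ IsBackwardSingularPoint v 0`, resp. the
  `LrcModEntire` germ (`…UntwistedIsoparametric.germ_of_leafwise` + the transfer).

WHAT THIS IS NOT: not a claim about Navier–Stokes regularity and not the stub `stub_untwisted` (whose remaining inputs are the lead's F2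
normal form `(K1)+(V0)`, F4 = branch 2b, and the assembly) — the class half of the isoparametric endgame (bears_on LADDER-NS N0 via crux
K2 = stmt-19708 and item stmt-20428).
-/

noncomputable section

-- the summit and its single sub-problem share the name (CONVENTIONS §1), as in every Theorems file
set_option linter.dupNamespace false

namespace Summit.NavierStokesRegularity.NavierStokesRegularity.Theorems.PoloidalWindowDoorPoloidalWindowRigidityUntwistedIsoparametricClass

open Set Function Filter Topology Metric
open scoped RealInnerProductSpace InnerProductSpace ContDiff
open Literature.Analysis Literature.Analysis.FluidPDE
open Summit.NavierStokesRegularity.NavierStokesRegularity.Theorems.LocalSineTubeDoorProfileAlignedWindowRigidityAncient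
open Summit.NavierStokesRegularity.NavierStokesRegularity.Theorems.PoloidalWindowDoorPoloidalWindowRigidityConstantShearMeans
open Summit.NavierStokesRegularity.NavierStokesRegularity.Theorems.PoloidalWindowDoorPoloidalWindowRigidityUntwistedIsoparametric
open Summit.NavierStokesRegularity.NavierStokesRegularity.Theorems.PoloidalWindowDoorLrcModEntireStreamSymmetryGerm
open Summit.NavierStokesRegularity.NavierStokesRegularity.Theorems.PoloidalWindowDoorPoloidalWindowRigidityStructureFunction
open Summit.NavierStokesRegularity.NavierStokesRegularity.Theorems.PoloidalWindowDoorPoloidalWindowRigidityLocalVorticitySymmetry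
open Summit.NavierStokesRegularity.NavierStokesRegularity.Theorems.PoloidalWindowDoorPoloidalWindowRigidityOneSliceCurlAxisymmetric
/-! ### Class transfer: a germ of `v₂(s,·)` is a germ of the Clebsch stream function, hence of the vorticity -/

variable {C : ℝ} {v : ℝ → EuclideanSpace ℝ (Fin 3) → EuclideanSpace ℝ (Fin 3)}

/-- **A rotation / horizontal-translation germ of the vertical velocity is a germ of the VORTICITY (class form).**  Let `v` be a profile of
the route's Type-I class, poloidal along `e₃`, `s < 0`, `V` open, `y₀ ∈ V` with `∇ₕv₂(s,y₀) ≠ 0`.  If `w = v₂(s,·)` satisfies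
`Dw(y)[J(y − c)] = 0` on `V` (some `c`) or `Dw(y)[e] = 0` on `V` (some horizontal `e ≠ 0`), then on an open `V' ∋ y₀`, `V' ⊆ V`, the
vorticity of the slice has the corresponding germ: `J curl v(s)(y) = D(curl v(s))(y)[J(y − c)]`, resp. `D(curl v(s))(y)[e] = 0`.
(The Clebsch stream function of the tree is `ψ(s,·) = F̃(s, v₂, y₂)` near `y₀` — `exists_clebsch_eq_structureFunction` — so it inherits
the germ by the chain rule; then `…StreamSymmetryGerm`.) [folklore] -/
theorem vorticityGerm_of_verticalVelocity_germ (hrate : HasTypeITimeDecay C v)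
    (hcont : ContinuousOn (uncurry v) (Iio (0 : ℝ) ×ˢ univ))
    (hmild : ∀ s t : ℝ, s < t → t < 0 → ∀ x,
      v t x = UnboundedOperators.heatExtension (v s) (t - s) x - oseenDuhamel 1 s v v t x)
    (hdiv : ∀ t < 0, VectorCalculus.IsDivFree (v t))
    (hpol : ∀ s < 0, ∀ y, ⟪curl (v s) y, EuclideanSpace.single 2 1⟫_ℝ = 0)
    {s : ℝ} (hs : s < 0) {V : Set (EuclideanSpace ℝ (Fin 3))} (hV : IsOpen V) {y₀ : EuclideanSpace ℝ (Fin 3)} (hy₀ : y₀ ∈ V)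
    (hnd : fderiv ℝ (v s) y₀ (EuclideanSpace.single 0 1) 2 ≠ 0 ∨ fderiv ℝ (v s) y₀ (EuclideanSpace.single 1 1) 2 ≠ 0)
    (hgerm : (∃ c : EuclideanSpace ℝ (Fin 3), ∀ y ∈ V, fderiv ℝ (fun x => v s x 2) y (rotGen (y - c)) = 0) ∨
      (∃ e : EuclideanSpace ℝ (Fin 3), e ≠ 0 ∧ e 2 = 0 ∧ ∀ y ∈ V, fderiv ℝ (fun x => v s x 2) y e = 0)) :
    ∃ V' : Set (EuclideanSpace ℝ (Fin 3)), IsOpen V' ∧ y₀ ∈ V' ∧ V' ⊆ V ∧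
      ((∃ e : EuclideanSpace ℝ (Fin 3), e ≠ 0 ∧ ∀ y ∈ V', fderiv ℝ (curl (v s)) y e = 0) ∨
       (∃ c : EuclideanSpace ℝ (Fin 3), ∀ y ∈ V', rotGen (curl (v s) y) = fderiv ℝ (curl (v s)) y (rotGen (y - c)))) := by
  -- the Clebsch pair of the tree and the structure function `ψ = F̃(t, v₂, y₂)` near `(s, y₀)`
  obtain ⟨φ, ψ, -, hψs, hall, -⟩ := exists_clebsch_structureFunction hrate hcont hmild hdiv hpol
  have hslabo : IsOpen (Iio (0 : ℝ) ×ˢ (univ : Set (EuclideanSpace ℝ (Fin 3)))) := isOpen_Iio.prod isOpen_univ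
  have hmem : (s, y₀) ∈ Iio (0 : ℝ) ×ˢ (univ : Set (EuclideanSpace ℝ (Fin 3))) := mk_mem_prod hs (mem_univ _)
  have hψ1 : ContDiffAt ℝ 1 (uncurry ψ) (s, y₀) := (hψs.contDiffAt (hslabo.mem_nhds hmem)).of_le (by norm_num)
  have hω : ∀ t < 0, ∀ y, curl (v t) y 0 = fderiv ℝ (ψ t) y (EuclideanSpace.single 1 1) ∧
      curl (v t) y 1 = -fderiv ℝ (ψ t) y (EuclideanSpace.single 0 1) := fun t ht y =>
    ⟨((hall t ht).2.2.1 y).1, ((hall t ht).2.2.1 y).2.1⟩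
  obtain ⟨F, hFc, hFeq⟩ := exists_clebsch_eq_structureFunction (n := 1) one_ne_zero hrate hcont hmild hdiv hpol hs hψ1 hω hnd
  -- the slice `ψ s` is `C²` on `ℝ³`
  have hψ2 : ContDiff ℝ 2 (ψ s) := by
    have h : ContDiff ℝ ∞ ((uncurry ψ) ∘ fun y : EuclideanSpace ℝ (Fin 3) => (s, y)) :=
      hψs.comp_contDiff (contDiff_const.prodMk contDiff_id) fun y => mk_mem_prod hs (mem_univ y)
    exact h.of_le (by norm_cast)
  have hωs : ∀ y, curl (v s) y 0 = fderiv ℝ (ψ s) y (EuclideanSpace.single 1 1) ∧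
      curl (v s) y 1 = -fderiv ℝ (ψ s) y (EuclideanSpace.single 0 1) ∧ curl (v s) y 2 = 0 := (hall s hs).2.2.1
  -- the slice is analytic, so `w = v₂(s,·)` is differentiable and continuous
  have hA : AnalyticOnNhd ℝ (v s) univ := analyticOnNhd_slice hcont (bdd_of_hasTypeITimeDecay hrate) hmild hs
  set w : EuclideanSpace ℝ (Fin 3) → ℝ := fun x => v s x 2 with hw
  have hwd : Differentiable ℝ w := fun y =>
    ((EuclideanSpace.proj (𝕜 := ℝ) (2 : Fin 3)).differentiableAt).comp y (hA y (mem_univ y)).differentiableAt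
  have hwc : Continuous w := hwd.continuous
  -- near `y₀` on the slice: `ψ s y = F (s, w y, y₂)` and `F` is differentiable at `(s, w y, y₂)`
  have hL : Continuous fun y : EuclideanSpace ℝ (Fin 3) => (s, w y, y 2) :=
    continuous_const.prodMk (hwc.prodMk (EuclideanSpace.proj (𝕜 := ℝ) (2 : Fin 3)).continuous)
  have hev1 : ∀ᶠ y in 𝓝 y₀, ψ s y = F (s, w y, y 2) := by
    have ht : Tendsto (fun y : EuclideanSpace ℝ (Fin 3) => (s, y)) (𝓝 y₀) (𝓝 (s, y₀)) :=
      (continuous_const.prodMk continuous_id).tendsto y₀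
    exact ht.eventually hFeq
  have hev2 : ∀ᶠ y in 𝓝 y₀, DifferentiableAt ℝ F (s, w y, y 2) := by
    have h1 : ∀ᶠ p in 𝓝 (s, w y₀, y₀ 2), ContDiffAt ℝ 1 F p := hFc.eventually (by simp)
    exact ((hL.tendsto y₀).eventually h1).mono fun y hy => hy.differentiableAt one_ne_zero
  have hev0 : ∀ᶠ y in 𝓝 y₀, y ∈ V := hV.mem_nhds hy₀
  obtain ⟨V', hV'sub, hV'o, hy₀V'⟩ := _root_.mem_nhds_iff.1 (hev0.and (hev1.and hev2))
  have hV'V : V' ⊆ V := fun y hy => (hV'sub hy).1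
  -- on `V'`: the derivative of `ψ s` along any horizontal vector annihilated by `Dw` vanishes
  have hkey : ∀ y ∈ V', ∀ X : EuclideanSpace ℝ (Fin 3), X 2 = 0 → fderiv ℝ w y X = 0 → fderiv ℝ (ψ s) y X = 0 := by
    intro y hy X hX2 hwX
    have hFd : DifferentiableAt ℝ F (s, w y, y 2) := (hV'sub hy).2.2
    have heq : ψ s =ᶠ[𝓝 y] fun y' => F (s, w y', y' 2) :=
      eventually_of_mem (hV'o.mem_nhds hy) fun y' hy' => (hV'sub hy').2.1
    rw [heq.fderiv_eq]
    have hLd : HasFDerivAt (fun y' : EuclideanSpace ℝ (Fin 3) => (s, w y', y' 2))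
        ((0 : EuclideanSpace ℝ (Fin 3) →L[ℝ] ℝ).prod ((fderiv ℝ w y).prod (EuclideanSpace.proj (𝕜 := ℝ) (2 : Fin 3)))) y :=
      (hasFDerivAt_const s y).prodMk ((hwd y).hasFDerivAt.prodMk (EuclideanSpace.proj (𝕜 := ℝ) (2 : Fin 3)).hasFDerivAt)
    have hc := hFd.hasFDerivAt.comp y hLd
    rw [show (fun y' : EuclideanSpace ℝ (Fin 3) => F (s, w y', y' 2)) = F ∘ fun y' => (s, w y', y' 2) from rfl, hc.fderiv,
      ContinuousLinearMap.comp_apply]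
    have e : ((0 : EuclideanSpace ℝ (Fin 3) →L[ℝ] ℝ).prod ((fderiv ℝ w y).prod (EuclideanSpace.proj (𝕜 := ℝ) (2 : Fin 3)))) X = 0 := by
      show ((0 : ℝ), (fderiv ℝ w y X, X 2)) = 0
      rw [hwX, hX2]; rfl
    rw [e, map_zero]
  refine ⟨V', hV'o, hy₀V', hV'V, ?_⟩
  rcases hgerm with ⟨c, hc⟩ | ⟨e, he, he2, htr⟩
  · right
    refine ⟨c, fun y hy => ?_⟩
    exact vorticity_rotation_germ_of_stream hψ2 hωs hV'o c
      (fun y' hy' => hkey y' hy' _ (by simp [rotGen]) (hc y' (hV'V hy'))) hy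
  · left
    refine ⟨e, he, fun y hy => ?_⟩
    exact vorticity_translation_germ_of_stream hψ2 hωs hV'o (fun y' hy' => hkey y' hy' e he2 (htr y' (hV'V hy'))) hy

/-- **`¬ IsBackwardSingularPoint` from a germ of the vertical velocity.**  Same setting; conclusion: the apex is regular (tree
`nonflatLiouville_of_local_curl_translation` / `nonflatLiouville_of_curl_rotDefect_eq_zero_on_open`). [folklore] -/
theorem not_isBackwardSingularPoint_of_verticalVelocity_germ (hrate : HasTypeITimeDecay C v)
    (hcont : ContinuousOn (uncurry v) (Iio (0 : ℝ) ×ˢ univ))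
    (hmild : ∀ s t : ℝ, s < t → t < 0 → ∀ x,
      v t x = UnboundedOperators.heatExtension (v s) (t - s) x - oseenDuhamel 1 s v v t x)
    (hdiv : ∀ t < 0, VectorCalculus.IsDivFree (v t))
    (hpol : ∀ s < 0, ∀ y, ⟪curl (v s) y, EuclideanSpace.single 2 1⟫_ℝ = 0)
    {s : ℝ} (hs : s < 0) {V : Set (EuclideanSpace ℝ (Fin 3))} (hV : IsOpen V) {y₀ : EuclideanSpace ℝ (Fin 3)} (hy₀ : y₀ ∈ V)
    (hnd : fderiv ℝ (v s) y₀ (EuclideanSpace.single 0 1) 2 ≠ 0 ∨ fderiv ℝ (v s) y₀ (EuclideanSpace.single 1 1) 2 ≠ 0)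
    (hgerm : (∃ c : EuclideanSpace ℝ (Fin 3), ∀ y ∈ V, fderiv ℝ (fun x => v s x 2) y (rotGen (y - c)) = 0) ∨
      (∃ e : EuclideanSpace ℝ (Fin 3), e ≠ 0 ∧ e 2 = 0 ∧ ∀ y ∈ V, fderiv ℝ (fun x => v s x 2) y e = 0)) :
    ¬ IsBackwardSingularPoint v 0 := by
  obtain ⟨V', hV'o, hy₀V', -, hcase⟩ := vorticityGerm_of_verticalVelocity_germ hrate hcont hmild hdiv hpol hs hV hy₀ hnd hgerm
  rcases hcase with ⟨e, he, htr⟩ | ⟨c, hrot⟩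
  · exact nonflatLiouville_of_local_curl_translation hrate hcont hmild hdiv hs he hV'o ⟨y₀, hy₀V'⟩ htr
  · exact nonflatLiouville_of_curl_rotDefect_eq_zero_on_open hrate hcont hmild hdiv hpol c hs hV'o ⟨y₀, hy₀V'⟩ hrot

/-- **The `LrcModEntire` germ from a germ of the vertical velocity** (item stmt-20428's currency, VERBATIM its conclusion). [folklore] -/
theorem lrcGerm_of_verticalVelocity_germ (hrate : HasTypeITimeDecay C v)
    (hcont : ContinuousOn (uncurry v) (Iio (0 : ℝ) ×ˢ univ))
    (hmild : ∀ s t : ℝ, s < t → t < 0 → ∀ x,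
      v t x = UnboundedOperators.heatExtension (v s) (t - s) x - oseenDuhamel 1 s v v t x)
    (hdiv : ∀ t < 0, VectorCalculus.IsDivFree (v t))
    (hpol : ∀ s < 0, ∀ y, ⟪curl (v s) y, EuclideanSpace.single 2 1⟫_ℝ = 0)
    {s : ℝ} (hs : s < 0) {V : Set (EuclideanSpace ℝ (Fin 3))} (hV : IsOpen V) {y₀ : EuclideanSpace ℝ (Fin 3)} (hy₀ : y₀ ∈ V)
    (hnd : fderiv ℝ (v s) y₀ (EuclideanSpace.single 0 1) 2 ≠ 0 ∨ fderiv ℝ (v s) y₀ (EuclideanSpace.single 1 1) 2 ≠ 0)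
    (hgerm : (∃ c : EuclideanSpace ℝ (Fin 3), ∀ y ∈ V, fderiv ℝ (fun x => v s x 2) y (rotGen (y - c)) = 0) ∨
      (∃ e : EuclideanSpace ℝ (Fin 3), e ≠ 0 ∧ e 2 = 0 ∧ ∀ y ∈ V, fderiv ℝ (fun x => v s x 2) y e = 0)) :
    ∃ s' : ℝ, s' < 0 ∧ ∃ U' : Set (EuclideanSpace ℝ (Fin 3)), IsOpen U' ∧ U'.Nonempty ∧
      ((∃ e : EuclideanSpace ℝ (Fin 3), e ≠ 0 ∧ ∀ y ∈ U', fderiv ℝ (curl (v s')) y e = 0) ∨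
       (∃ c : EuclideanSpace ℝ (Fin 3), ∀ y ∈ U',
          rotGen (curl (v s') y) = fderiv ℝ (curl (v s')) y (rotGen (y - c))) ∨
       (∃ w : EuclideanSpace ℝ (Fin 3) → EuclideanSpace ℝ (Fin 3), AnalyticOnNhd ℝ w univ ∧
          ¬ BddAbove (Set.range fun y => ‖w y‖) ∧ ∀ y ∈ U', v s' y = w y)) := by
  obtain ⟨V', hV'o, hy₀V', -, hcase⟩ := vorticityGerm_of_verticalVelocity_germ hrate hcont hmild hdiv hpol hs hV hy₀ hnd hgerm
  rcases hcase with htr | hrot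
  · exact ⟨s, hs, V', hV'o, ⟨y₀, hy₀V'⟩, Or.inl htr⟩
  · exact ⟨s, hs, V', hV'o, ⟨y₀, hy₀V'⟩, Or.inr (Or.inl hrot)⟩

/-! ### Brick F5 assembled: class + untwisted + isoparametric leaves ⇒ regular -/

/-- **BRICK F5 — ISOPARAMETRIC LEAVES OF AN UNTWISTED CLASS PROFILE ⇒ THE APEX IS REGULAR.**  Let `v` be a profile of the route's
Type-I class, poloidal along `e₃`, `s < 0`, `w = v₂(s,·)`, `U` open, `y₀ ∈ U` with `∇ₕw(y₀) ≠ 0`.  Suppose on `U`: `∂₂w = P(w,y₂)` with `P`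
of class `C¹` at the leaf points (UNTWISTED — bricks F1/F3), and `(∂₀w)² + (∂₁w)² = a(w,y₂)`, `∂₀∂₀w + ∂₁∂₁w = b(w,y₂)` with `a ∈ C²`,
`b ∈ C¹` at `(w y₀, (y₀)₂)` (ISOPARAMETRIC LEAVES — the conclusion of the lead's separation `…UntwistedSeparation{,2}` where its
Wronskian is non-zero).  Then `v` is not backward-singular at the apex (`germ_of_leafwise` + `not_isBackwardSingularPoint_of_verticalVelocity_germ`).
[folklore] -/
theorem not_isBackwardSingularPoint_of_leafwise (hrate : HasTypeITimeDecay C v)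
    (hcont : ContinuousOn (uncurry v) (Iio (0 : ℝ) ×ˢ univ))
    (hmild : ∀ s t : ℝ, s < t → t < 0 → ∀ x,
      v t x = UnboundedOperators.heatExtension (v s) (t - s) x - oseenDuhamel 1 s v v t x)
    (hdiv : ∀ t < 0, VectorCalculus.IsDivFree (v t))
    (hpol : ∀ s < 0, ∀ y, ⟪curl (v s) y, EuclideanSpace.single 2 1⟫_ℝ = 0)
    {s : ℝ} (hs : s < 0) {U : Set (EuclideanSpace ℝ (Fin 3))} (hU : IsOpen U) {y₀ : EuclideanSpace ℝ (Fin 3)} (hy₀ : y₀ ∈ U)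
    {P a b : ℝ × ℝ → ℝ}
    (hPd : ∀ y ∈ U, ContDiffAt ℝ 1 P (v s y 2, y 2))
    (hP : ∀ y ∈ U, fderiv ℝ (fun x => v s x 2) y (EuclideanSpace.single 2 (1 : ℝ)) = P (v s y 2, y 2))
    (ha : ContDiffAt ℝ 2 a (v s y₀ 2, y₀ 2)) (hb : ContDiffAt ℝ 1 b (v s y₀ 2, y₀ 2))
    (hE : ∀ y ∈ U, fderiv ℝ (fun x => v s x 2) y (EuclideanSpace.single 0 (1 : ℝ)) ^ 2 +
      fderiv ℝ (fun x => v s x 2) y (EuclideanSpace.single 1 (1 : ℝ)) ^ 2 = a (v s y 2, y 2))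
    (hM : ∀ y ∈ U, fderiv ℝ (fun y' => fderiv ℝ (fun x => v s x 2) y' (EuclideanSpace.single 0 (1 : ℝ))) y (EuclideanSpace.single 0 (1 : ℝ)) +
      fderiv ℝ (fun y' => fderiv ℝ (fun x => v s x 2) y' (EuclideanSpace.single 1 (1 : ℝ))) y (EuclideanSpace.single 1 (1 : ℝ)) =
        b (v s y 2, y 2))
    (hnd : fderiv ℝ (fun x => v s x 2) y₀ (EuclideanSpace.single 0 (1 : ℝ)) ≠ 0 ∨
      fderiv ℝ (fun x => v s x 2) y₀ (EuclideanSpace.single 1 (1 : ℝ)) ≠ 0) :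
    ¬ IsBackwardSingularPoint v 0 := by
  have hA : AnalyticOnNhd ℝ (v s) univ := analyticOnNhd_slice hcont (bdd_of_hasTypeITimeDecay hrate) hmild hs
  have hw3 : ContDiff ℝ 3 (fun x => v s x 2) := contDiff_coord hA.contDiff 2
  obtain ⟨V, hVo, hVne, hVU, hVnd, hgerm⟩ :=
    germ_of_leafwise (w := fun x => v s x 2) hU hw3 hPd hP hy₀ ha hb hE hM hnd
  obtain ⟨y₁, hy₁⟩ := hVne
  have hnd₁ : fderiv ℝ (v s) y₁ (EuclideanSpace.single 0 1) 2 ≠ 0 ∨ fderiv ℝ (v s) y₁ (EuclideanSpace.single 1 1) 2 ≠ 0 := by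
    have hd : DifferentiableAt ℝ (v s) y₁ := (hA y₁ (mem_univ _)).differentiableAt
    rw [← fderiv_coord_apply hd 2, ← fderiv_coord_apply hd 2]
    exact hVnd y₁ hy₁
  exact not_isBackwardSingularPoint_of_verticalVelocity_germ hrate hcont hmild hdiv hpol hs hVo hy₁ hnd₁ hgerm

/-- **Brick F5 in the currency of item `LrcModEntire` (stmt-20428): the germ trichotomy (first two legs) on a slice.**  Same hypotheses as
`not_isBackwardSingularPoint_of_leafwise`; conclusion VERBATIM the item's. [folklore] -/
theorem lrcGerm_of_leafwise (hrate : HasTypeITimeDecay C v)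
    (hcont : ContinuousOn (uncurry v) (Iio (0 : ℝ) ×ˢ univ))
    (hmild : ∀ s t : ℝ, s < t → t < 0 → ∀ x,
      v t x = UnboundedOperators.heatExtension (v s) (t - s) x - oseenDuhamel 1 s v v t x)
    (hdiv : ∀ t < 0, VectorCalculus.IsDivFree (v t))
    (hpol : ∀ s < 0, ∀ y, ⟪curl (v s) y, EuclideanSpace.single 2 1⟫_ℝ = 0)
    {s : ℝ} (hs : s < 0) {U : Set (EuclideanSpace ℝ (Fin 3))} (hU : IsOpen U) {y₀ : EuclideanSpace ℝ (Fin 3)} (hy₀ : y₀ ∈ U)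
    {P a b : ℝ × ℝ → ℝ}
    (hPd : ∀ y ∈ U, ContDiffAt ℝ 1 P (v s y 2, y 2))
    (hP : ∀ y ∈ U, fderiv ℝ (fun x => v s x 2) y (EuclideanSpace.single 2 (1 : ℝ)) = P (v s y 2, y 2))
    (ha : ContDiffAt ℝ 2 a (v s y₀ 2, y₀ 2)) (hb : ContDiffAt ℝ 1 b (v s y₀ 2, y₀ 2))
    (hE : ∀ y ∈ U, fderiv ℝ (fun x => v s x 2) y (EuclideanSpace.single 0 (1 : ℝ)) ^ 2 +
      fderiv ℝ (fun x => v s x 2) y (EuclideanSpace.single 1 (1 : ℝ)) ^ 2 = a (v s y 2, y 2))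
    (hM : ∀ y ∈ U, fderiv ℝ (fun y' => fderiv ℝ (fun x => v s x 2) y' (EuclideanSpace.single 0 (1 : ℝ))) y (EuclideanSpace.single 0 (1 : ℝ)) +
      fderiv ℝ (fun y' => fderiv ℝ (fun x => v s x 2) y' (EuclideanSpace.single 1 (1 : ℝ))) y (EuclideanSpace.single 1 (1 : ℝ)) =
        b (v s y 2, y 2))
    (hnd : fderiv ℝ (fun x => v s x 2) y₀ (EuclideanSpace.single 0 (1 : ℝ)) ≠ 0 ∨
      fderiv ℝ (fun x => v s x 2) y₀ (EuclideanSpace.single 1 (1 : ℝ)) ≠ 0) :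
    ∃ s' : ℝ, s' < 0 ∧ ∃ U' : Set (EuclideanSpace ℝ (Fin 3)), IsOpen U' ∧ U'.Nonempty ∧
      ((∃ e : EuclideanSpace ℝ (Fin 3), e ≠ 0 ∧ ∀ y ∈ U', fderiv ℝ (curl (v s')) y e = 0) ∨
       (∃ c : EuclideanSpace ℝ (Fin 3), ∀ y ∈ U',
          rotGen (curl (v s') y) = fderiv ℝ (curl (v s')) y (rotGen (y - c))) ∨
       (∃ w : EuclideanSpace ℝ (Fin 3) → EuclideanSpace ℝ (Fin 3), AnalyticOnNhd ℝ w univ ∧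
          ¬ BddAbove (Set.range fun y => ‖w y‖) ∧ ∀ y ∈ U', v s' y = w y)) := by
  have hA : AnalyticOnNhd ℝ (v s) univ := analyticOnNhd_slice hcont (bdd_of_hasTypeITimeDecay hrate) hmild hs
  have hw3 : ContDiff ℝ 3 (fun x => v s x 2) := contDiff_coord hA.contDiff 2
  obtain ⟨V, hVo, hVne, hVU, hVnd, hgerm⟩ :=
    germ_of_leafwise (w := fun x => v s x 2) hU hw3 hPd hP hy₀ ha hb hE hM hnd
  obtain ⟨y₁, hy₁⟩ := hVne
  have hnd₁ : fderiv ℝ (v s) y₁ (EuclideanSpace.single 0 1) 2 ≠ 0 ∨ fderiv ℝ (v s) y₁ (EuclideanSpace.single 1 1) 2 ≠ 0 := by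
    have hd : DifferentiableAt ℝ (v s) y₁ := (hA y₁ (mem_univ _)).differentiableAt
    rw [← fderiv_coord_apply hd 2, ← fderiv_coord_apply hd 2]
    exact hVnd y₁ hy₁
  exact lrcGerm_of_verticalVelocity_germ hrate hcont hmild hdiv hpol hs hVo hy₁ hnd₁ hgerm

end Summit.NavierStokesRegularity.NavierStokesRegularity.Theorems.PoloidalWindowDoorPoloidalWindowRigidityUntwistedIsoparametricClass

end
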